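import Literature.AlgebraicTopology.CharacteristicClasses.ProjectiveSpaceLerayHirsch
import Literature.AlgebraicTopology.SingularHomology.CompactGroupExteriorCohomology
import HarnessLib

/-!
# The Segre map pulls the hyperplane class back to the sum of the two hyperplane classes

R. Hartshorne, *Algebraic Geometry* (1977), II Ex. 5.11: under the Segre embedding
`ℙʳ × ℙˢ ↪ ℙᴺ` the twisting sheaf `𝒪(1)` restricts to `p₁^* 𝒪(1) ⊗ p₂^* 𝒪(1)`; on first Chern (= Euler)
classes this is the additivity `σ^* h_N = p₁^* h_r + p₂^* h_s` (A. Hatcher, *Vector Bundles and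
K-Theory*, Prop. 3.10; J. Milnor, J. Stasheff, *Characteristic Classes*, §14). This file proves the
cohomological identity for the tree's Euler class `x_V = e(γ¹(V)) ∈ H²(ℙ(V); R)` of the tautological
line bundle (`tautEuler`, `TautologicalEulerClass`), over any commutative coefficient ring `R` and for
ANY continuous map `s : ℙ(ℂᵃ⁺¹) × ℙ(ℂᵇ⁺¹) → ℙ(ℂⁿ⁺¹)` given on points by `([z], [w]) ↦ [z ⊗ w]` for a
chosen enumeration `e : (a+1) × (b+1) ≃ n+1` of the coordinates `zᵢ wⱼ`:

* `map_segre_tautEuler` — **`s^* x_n = pr₁^* x_a + pr₂^* x_b` in `H²(ℙ(ℂᵃ⁺¹) × ℙ(ℂᵇ⁺¹); R)`.**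

The proof is the standard slice argument and uses no tensor products of bundles: by the
Leray–Hirsch theorem for `U × ℙ(V) → U` (the tree's `projectiveSpace_lerayHirsch`, Husemoller Ch. 17
Thm. 2.5) every class of `H²(ℙ(ℂᵃ⁺¹) × ℙ(ℂᵇ⁺¹))` is `pr₁^* a₀ + r • pr₂^* x_b`
(`exists_eq_lerayHirsch_two`, with `H⁰(ℙ(ℂᵃ⁺¹)) = R · 1` by path-connectedness,
`pathConnectedSpace_projectivization_fin`); the coefficients of `s^* x_n` are read off by restricting
to the slices `ℙ(ℂᵃ⁺¹) × [w₀]` and `[z₀] × ℙ(ℂᵇ⁺¹)`, on which `s` is the projectivisation of the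
injective linear maps `z ↦ z ⊗ w₀`, `w ↦ z₀ ⊗ w`, so that naturality of `x` (`tautEuler_map`,
Husemoller Ch. 17 Prop. 3.3) gives `a₀ = x_a` and `r • x_b = x_b`.

Theorems only; no definitions, no named facts. Consumer: the hyperplane-class calculus on the
complex points of `ℙᴺ_ℂ` (Segre additivity for projective embeddings of products of varieties).

## References

* [Hartshorne1977] R. Hartshorne, *Algebraic Geometry*, GTM 52 (1977), II Ex. 5.11.
* [HatcherVBKT2017] A. Hatcher, *Vector Bundles and K-Theory* (v2.2, 2017), Prop. 3.10.
* [HusemollerFibreBundles1994] D. Husemoller, *Fibre Bundles*, 3rd ed. (1994), Ch. 17 §2 Thm. 2.5,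
  §3 Prop. 3.3.
* [HatcherAT2002] A. Hatcher, *Algebraic Topology* (2002), §3.1 p. 199, §3.2 Thm. 3.16.
* [GriffithsHarrisPrinciples1978] P. Griffiths, J. Harris, *Principles of Algebraic Geometry*
  (1978), Ch. 0 §2 p. 15 (`ℙⁿ` as a quotient of `ℂⁿ⁺¹ ∖ 0`).
-/

noncomputable section

open Function Literature.AlgebraicTopology.SingularHomology
open scoped LinearAlgebra.Projectivization

namespace Literature.AlgebraicTopology.CharacteristicClasses

variable (R : Type) [CommRing R]

/-- **`ℙ(ℂᴺ⁺¹)` is path connected**: it is the continuous image of `ℂᴺ⁺¹ ∖ {0}`, which is path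
connected since `ℂᴺ⁺¹` has real dimension `> 1` (Mathlib
`isPathConnected_compl_singleton_of_one_lt_rank`). [cite: GriffithsHarrisPrinciples1978, Ch. 0 §2 p. 15] -/
theorem pathConnectedSpace_projectivization_fin (N : ℕ) :
    PathConnectedSpace (ℙ ℂ (Fin (N + 1) → ℂ)) := by
  have h1 : 1 < Module.rank ℝ (Fin (N + 1) → ℂ) := by
    apply Module.one_lt_rank_of_one_lt_finrank
    rw [Module.finrank_pi_fintype, Finset.sum_const, Finset.card_univ, Fintype.card_fin,
      Complex.finrank_real_complex, smul_eq_mul]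
    omega
  haveI : PathConnectedSpace {v : Fin (N + 1) → ℂ // v ≠ 0} :=
    isPathConnected_iff_pathConnectedSpace.1 (isPathConnected_compl_singleton_of_one_lt_rank h1 0)
  exact (Projectivization.isQuotientMap_mk (𝕜 := ℂ) (W := Fin (N + 1) → ℂ)).surjective.pathConnectedSpace
    Projectivization.continuous_mk

variable {V : Type} [NormedAddCommGroup V] [NormedSpace ℂ V] [FiniteDimensional ℂ V]

/-- **Leray–Hirsch in degree two**: for `dim V = b + 1` and any space `U`, every class of
`H²(U × ℙ(V); R)` is `pr₁^* a₀ + pr₁^* a₁ ⌣ pr₂^* x` with `a₀ ∈ H²(U)`, `a₁ ∈ H⁰(U)` and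
`x = e(γ¹(V))` (the surjectivity half of `projectiveSpace_lerayHirsch` in degree `2`, where only the
classes `1` and `x` contribute). [cite: HusemollerFibreBundles1994, Ch. 17 §2 Thm. 2.5] -/
theorem exists_eq_lerayHirsch_two {U : Type} [TopologicalSpace U] {b : ℕ}
    (hV : Module.finrank ℂ V = b + 1) (c : singularCohomology R R (U × ℙ ℂ V) 2) :
    ∃ (a₀ : singularCohomology R R U 2) (a₁ : singularCohomology R R U 0),
      c = singularCohomology.map R R (ContinuousMap.fst : C(U × ℙ ℂ V, U)) 2 a₀ +
        cupProduct (show 0 + 2 = 2 from rfl)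
          (singularCohomology.map R R (ContinuousMap.fst : C(U × ℙ ℂ V, U)) 0 a₁)
          (singularCohomology.map R R (ContinuousMap.snd : C(U × ℙ ℂ V, ℙ ℂ V)) 2 (tautEuler V R 1)) := by
  obtain ⟨a, ha⟩ := (projectiveSpace_lerayHirsch R b V hV U 2).2 c
  rw [LerayHirsch.lhMap_apply] at ha
  -- the `j = 0` term is `pr₁^* a₀ ⌣ pr₂^* 1 = pr₁^* a₀`
  have hT0 : ∀ (h0 : LerayHirsch.evenDeg (b + 1) 0 ≤ 2),
      cupProduct (Nat.sub_add_cancel h0)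
        (singularCohomology.map R R (ContinuousMap.fst : C(U × ℙ ℂ V, U)) (2 - LerayHirsch.evenDeg (b + 1) 0)
          (a ⟨0, h0⟩)) (projCls R V U (b + 1) 0) =
      singularCohomology.map R R (ContinuousMap.fst : C(U × ℙ ℂ V, U)) 2 (a ⟨0, h0⟩) := by
    intro h0
    change cupProduct (show 2 + 0 = 2 from rfl)
      (singularCohomology.map R R (ContinuousMap.fst : C(U × ℙ ℂ V, U)) 2 (a ⟨0, h0⟩))
      (singularCohomology.map R R (ContinuousMap.snd : C(U × ℙ ℂ V, ℙ ℂ V)) 0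
        (singularCohomology.one R (ℙ ℂ V))) = _
    rw [singularCohomology.map_one]
    exact cupProduct_one' R _ _
  cases b with
  | zero =>
    have h0 : LerayHirsch.evenDeg 1 0 ≤ 2 := Nat.zero_le _
    refine ⟨a ⟨0, h0⟩, 0, ?_⟩
    rw [Fintype.sum_eq_single (0 : Fin 1) (fun j hj => absurd (Subsingleton.elim j 0) hj),
      dif_pos h0, hT0 h0] at ha
    have hz : singularCohomology.map R R (ContinuousMap.fst : C(U × ℙ ℂ V, U)) 0
        (0 : singularCohomology R R U 0) = 0 := map_zero _
    rw [hz, LinearMap.map_zero₂, add_zero]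
    exact ha.symm
  | succ b =>
    have h0 : LerayHirsch.evenDeg (b + 2) 0 ≤ 2 := Nat.zero_le _
    have h1 : LerayHirsch.evenDeg (b + 2) 1 ≤ 2 := by change 2 * 1 ≤ 2; omega
    refine ⟨a ⟨0, h0⟩, a ⟨1, h1⟩, ?_⟩
    -- the `j = 1` term is `pr₁^* a₁ ⌣ pr₂^* x`
    have hT1 : cupProduct (Nat.sub_add_cancel h1)
        (singularCohomology.map R R (ContinuousMap.fst : C(U × ℙ ℂ V, U)) (2 - LerayHirsch.evenDeg (b + 2) 1)
          (a ⟨1, h1⟩)) (projCls R V U (b + 2) 1) =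
        cupProduct (show 0 + 2 = 2 from rfl)
          (singularCohomology.map R R (ContinuousMap.fst : C(U × ℙ ℂ V, U)) 0 (a ⟨1, h1⟩))
          (singularCohomology.map R R (ContinuousMap.snd : C(U × ℙ ℂ V, ℙ ℂ V)) 2 (tautEuler V R 1)) := by
      change cupProduct (show 0 + 2 = 2 from rfl)
        (singularCohomology.map R R (ContinuousMap.fst : C(U × ℙ ℂ V, U)) 0 (a ⟨1, h1⟩))
        (singularCohomology.map R R (ContinuousMap.snd : C(U × ℙ ℂ V, ℙ ℂ V)) 2
          (cupProduct (show 0 + 2 = 2 from rfl) (singularCohomology.one R (ℙ ℂ V)) (tautEuler V R 1))) = _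
      rw [one_cupProduct']
    rw [Fintype.sum_eq_add (0 : Fin (b + 2)) (1 : Fin (b + 2)) (by simp) (fun j hj => ?_),
      dif_pos h0, dif_pos h1, hT0 h0, hT1] at ha
    · exact ha.symm
    · obtain ⟨j, hj'⟩ := j
      have hj2 : 2 ≤ j := by
        rcases hj with ⟨hja, hjb⟩
        have : j ≠ 0 := fun h => hja (Fin.ext h)
        have : j ≠ 1 := fun h => hjb (Fin.ext h)
        omega
      exact dif_neg (by change ¬ (2 * j ≤ 2); omega)

/-- **The Segre map pulls the hyperplane class back to the sum of the hyperplane classes.** Let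
`e : (a+1) × (b+1) ≃ n+1` enumerate the Segre coordinates and let
`s : ℙ(ℂᵃ⁺¹) × ℙ(ℂᵇ⁺¹) → ℙ(ℂⁿ⁺¹)` be a continuous map with `s([z], [w]) = [z ⊗ w]`,
`(z ⊗ w)_{e(i,j)} = zᵢ wⱼ`. Then `s^* x_n = pr₁^* x_a + pr₂^* x_b` for the Euler classes
`x = e(γ¹)` of the tautological line bundles (Hartshorne II Ex. 5.11: `σ^* 𝒪(1) = 𝒪(1) ⊠ 𝒪(1)`;
Hatcher VBKT Prop. 3.10 for the first Chern class of a tensor product of line bundles). Proof by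
restriction to the slices `ℙ(ℂᵃ⁺¹) × [w₀]`, `[z₀] × ℙ(ℂᵇ⁺¹)` (projectivised linear injections,
`tautEuler_map`) and the degree-two Leray–Hirsch decomposition `exists_eq_lerayHirsch_two`.
[cite: Hartshorne1977, II Ex. 5.11] [cite: HatcherVBKT2017, Prop. 3.10] -/
theorem map_segre_tautEuler {a b n : ℕ} (e : Fin (a + 1) × Fin (b + 1) ≃ Fin (n + 1))
    (s : C(ℙ ℂ (Fin (a + 1) → ℂ) × ℙ ℂ (Fin (b + 1) → ℂ), ℙ ℂ (Fin (n + 1) → ℂ)))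
    (hs : ∀ (z : Fin (a + 1) → ℂ) (hz : z ≠ 0) (w : Fin (b + 1) → ℂ) (hw : w ≠ 0)
      (hzw : (fun t => z (e.symm t).1 * w (e.symm t).2) ≠ 0),
      s (Projectivization.mk ℂ z hz, Projectivization.mk ℂ w hw) = Projectivization.mk ℂ _ hzw) :
    singularCohomology.map R R s 2 (tautEuler (Fin (n + 1) → ℂ) R 1) =
      singularCohomology.map R R
          (ContinuousMap.fst : C(ℙ ℂ (Fin (a + 1) → ℂ) × ℙ ℂ (Fin (b + 1) → ℂ), ℙ ℂ (Fin (a + 1) → ℂ))) 2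
          (tautEuler (Fin (a + 1) → ℂ) R 1) +
        singularCohomology.map R R
          (ContinuousMap.snd : C(ℙ ℂ (Fin (a + 1) → ℂ) × ℙ ℂ (Fin (b + 1) → ℂ), ℙ ℂ (Fin (b + 1) → ℂ))) 2
          (tautEuler (Fin (b + 1) → ℂ) R 1) := by
  set A := ℙ ℂ (Fin (a + 1) → ℂ)
  set B := ℙ ℂ (Fin (b + 1) → ℂ)
  set xA := tautEuler (Fin (a + 1) → ℂ) R 1
  set xB := tautEuler (Fin (b + 1) → ℂ) R 1
  set xN := tautEuler (Fin (n + 1) → ℂ) R 1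
  -- the Segre vector `z ⊗ w` is non-zero for `z, w ≠ 0`
  have hne : ∀ {z : Fin (a + 1) → ℂ} {w : Fin (b + 1) → ℂ}, z ≠ 0 → w ≠ 0 →
      (fun t => z (e.symm t).1 * w (e.symm t).2) ≠ 0 := by
    intro z w hz hw
    obtain ⟨i, hi⟩ := Function.ne_iff.mp hz
    obtain ⟨j, hj⟩ := Function.ne_iff.mp hw
    exact Function.ne_iff.mpr ⟨e (i, j), by simpa using mul_ne_zero hi hj⟩
  -- base points `[1 : … : 1]`
  have h1a : (fun _ => 1 : Fin (a + 1) → ℂ) ≠ 0 := fun h => one_ne_zero (congr_fun h 0)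
  have h1b : (fun _ => 1 : Fin (b + 1) → ℂ) ≠ 0 := fun h => one_ne_zero (congr_fun h 0)
  set p₀ : A := Projectivization.mk ℂ _ h1a
  set q₀ : B := Projectivization.mk ℂ _ h1b
  -- the linear injections `z ↦ z ⊗ 1`, `w ↦ 1 ⊗ w`
  let LA : (Fin (a + 1) → ℂ) →ₗ[ℂ] (Fin (n + 1) → ℂ) :=
    { toFun := fun z t => z (e.symm t).1 * (fun _ => 1 : Fin (b + 1) → ℂ) (e.symm t).2
      map_add' := fun z z' => funext fun t => by simp
      map_smul' := fun c z => funext fun t => by simp }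
  let LB : (Fin (b + 1) → ℂ) →ₗ[ℂ] (Fin (n + 1) → ℂ) :=
    { toFun := fun w t => (fun _ => 1 : Fin (a + 1) → ℂ) (e.symm t).1 * w (e.symm t).2
      map_add' := fun w w' => funext fun t => by simp [mul_add]
      map_smul' := fun c w => funext fun t => by simp [mul_left_comm] }
  have hLA : Injective LA := by
    refine (injective_iff_map_eq_zero _).2 fun z hz => funext fun i => ?_
    simpa [LA] using congr_fun hz (e (i, 0))
  have hLB : Injective LB := by
    refine (injective_iff_map_eq_zero _).2 fun w hw => funext fun j => ?_
    simpa [LB] using congr_fun hw (e (0, j))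
  -- the slices and what `s`, `pr₁`, `pr₂` restrict to
  set jL : C(A, A × B) := ContinuousMap.prodMk (ContinuousMap.id _) (ContinuousMap.const _ q₀)
  set jR : C(B, A × B) := ContinuousMap.prodMk (ContinuousMap.const _ p₀) (ContinuousMap.id _)
  have hsL : s.comp jL = projMapC LA hLA := by
    ext p
    induction p using Projectivization.ind with
    | h z hz =>
      rw [ContinuousMap.comp_apply, projMapC_apply, Projectivization.map_mk]
      exact hs z hz _ h1b (hne hz h1b)
  have hsR : s.comp jR = projMapC LB hLB := by
    ext q
    induction q using Projectivization.ind with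
    | h w hw =>
      rw [ContinuousMap.comp_apply, projMapC_apply, Projectivization.map_mk]
      exact hs _ h1a w hw (hne h1a hw)
  have hfstL : (ContinuousMap.fst : C(A × B, A)).comp jL = ContinuousMap.id _ := by ext; rfl
  have hsndL : (ContinuousMap.snd : C(A × B, B)).comp jL = ContinuousMap.const _ q₀ := by ext; rfl
  have hfstR : (ContinuousMap.fst : C(A × B, A)).comp jR = ContinuousMap.const _ p₀ := by ext; rfl
  have hsndR : (ContinuousMap.snd : C(A × B, B)).comp jR = ContinuousMap.id _ := by ext; rfl
  -- Leray–Hirsch decomposition of `s^* x_n`, with `a₁ = r • 1` (`A` is path connected)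
  obtain ⟨a₀, a₁, hc⟩ := exists_eq_lerayHirsch_two R (V := Fin (b + 1) → ℂ) (U := A) (b := b)
    (Module.finrank_fin_fun ℂ) (singularCohomology.map R R s 2 xN)
  haveI := pathConnectedSpace_projectivization_fin a
  set r : R := singularCohomologyZeroEquiv R R A a₁
  have hc' : singularCohomology.map R R s 2 xN =
      singularCohomology.map R R (ContinuousMap.fst : C(A × B, A)) 2 a₀ +
        r • singularCohomology.map R R (ContinuousMap.snd : C(A × B, B)) 2 xB := by
    rw [hc, singularCohomology.eq_smul_one R a₁, map_smul, singularCohomology.map_one, smul_cupProduct,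
      one_cupProduct']
  -- restrict along `jL`: `a₀ = x_a`
  have key1 : a₀ = xA := by
    have h := congr_arg (singularCohomology.map R R jL 2) hc'
    rw [map_add, map_smul, singularCohomology.map_map, singularCohomology.map_map,
      singularCohomology.map_map, hsL, hfstL, hsndL, ← tautEuler_map, singularCohomology.map_id,
      singularCohomology.map_const_of_ne_zero R q₀ two_ne_zero, smul_zero, add_zero] at h
    exact h.symm
  -- restrict along `jR`: `r • x_b = x_b`
  have key2 : r • xB = xB := by
    have h := congr_arg (singularCohomology.map R R jR 2) hc'
    rw [map_add, map_smul, singularCohomology.map_map, singularCohomology.map_map,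
      singularCohomology.map_map, hsR, hfstR, hsndR, ← tautEuler_map, singularCohomology.map_id,
      singularCohomology.map_const_of_ne_zero R p₀ two_ne_zero, zero_add] at h
    exact h.symm
  rw [hc', key1, ← map_smul, key2]

end Literature.AlgebraicTopology.CharacteristicClasses

end
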